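import Mathlib
import HarnessLib
import HarnessLib.Audit
import Summits.AtomisticToContinuum.Statement
import Literature.MathematicalPhysics.QuantumManyBody.PeriodicBoseGas

/-!
Route: BECPolarBlockRG

CLOSED (retired) 2026-08-15T13:39:49Z by operator:999:1257524 — reason: not-a-thesis: assembly does not conclude the sub-problem Statement — note: D-0027 §2.1 audit (human 2026-08-15: routes that do not decide the summit are removed): the assembly concludes `Literature.MathematicalPhysics.QuantumManyBody.BoseGas.BoseEinsteinCondensation`, not the sub-problem statement; a NEW conforming route may be opened from the same idea (generated `closes . The file is kept as the record of this route; refuted decls are indexed as negative knowledge (`ledger negatives`).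

# Route BECPolarBlockRG — Popov after blocking — polar block variables at the Fournais scale, then
stiff-phase lattice long-range order tolerant of generic irrelevant perturbations

It suffices to show X = StiffPhaseLRO ∧ PolarTransfer ∧ BoundaryTransferWeak (realises card
popov-polar-blocking-irrelevant-rg).
StiffPhaseLRO (ENGINE, Literature-grade lattice statement, independent of the Bose gas): on the
(3+1)-torus ((ℤ/(m+2))³ × ℤ/(n+2)), every
compact-phase Gibbs measure ∝ e^(−H(θ)) whose bond potentials U_i are XY-SANDWICHED, K(1−cos η) ≤
U_i(η) ≤ ΛK(1−cos η), and whose remaining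
interaction w is local (range R), 2π-periodic and dominated by ε₀·K·(local XY energy) — no
Villain/cosine form, no reflection positivity, either
sign — has equal-time two-point function ⟨cos(θ_x − θ_y)⟩ ≥ 1 − C/K for K ≥ K₀(Λ,R), uniformly in m,
n, x, y.
PolarTransfer (THE BET): StiffPhaseLRO ⇒ BlockPhaseCoherence, i.e. uniform pairwise coherence ≥
c·ρℓ³ between ALL mesoscopic blocks (side
ℓ ∈ [ℓ₀, ℓ₁] fixed, inside the Fournais window) of every δ-near-minimiser of the periodic N-body
energy on the torus of side (N/ρ)^(1/3), ρ < ρ₀: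
block at the Fournais scale, pass to POLAR block variables (√n_B, θ_B), integrate the massive
density fluctuations in the number–phase
representation (real weights), and land in the class of the engine with stiffness K ≍
(ℓ/ξ)²(ρa³)^(−1/2) → ∞ and ε ≍ (ρa³)^η → 0.
BoundaryTransferWeak (shared verbatim with BECPeriodicReduction, stmt-AtomisticToContinuum-0827):
periodic constant-mode condensation ⇒ the
Dirichlet, mode-free HasGroundStateBEC. The glue BlockPhaseCoherence ⇒ PeriodicBEC (stmt-0826 body)
is bilinearity of the occupation form.
Lean: `StiffPhaseLRO ∧ PolarTransfer ∧ BoundaryTransferWeak`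

## Assembly
Pure logic (theorem assembly_provable in Sketch.lean, rc 0, no sorry): given hE : StiffPhaseLRO, hT
: PolarTransfer, hG : BlockCoherenceToPeriodicBEC,
hB : BoundaryTransferWeak and v repulsive finite-range, hB v hv (hG (hT hE) v hv) is exactly the
body of BoseEinsteinCondensation (∃ρ₀ > 0 ∀ρ ∈ (0,ρ₀)
HasGroundStateBEC v ρ). The conjunct is reached through
Literature.MathematicalPhysics.QuantumManyBody.BoseGas.BoseEinsteinCondensation, which is
definitionally the
sub-problem abbrev `BoseEinsteinCondensation`
(Summits/AtomisticToContinuum/BoseEinsteinCondensation/Statement.lean). BlockOccupationLD and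
QuarticPerturbedXYLRO are inputs /
milestones of PolarTransfer and StiffPhaseLRO respectively and deliberately not hypotheses of the
assembly.

Rationale: WHY THIS LINE. Change variables so that the infrared problem has nothing marginal left, then use the
most robust lattice engine: in POLAR block variables at a
scale ℓ ≫ ξ where block condensation and LHY-precision energies are theorems of the tree
(Fournais2020_condensation_holds,
LSSY2005_lowerBound_neumann_holds, LSSY2005_upperBound_periodic_holds), the amplitude is massive and
its zero set a large deviation of rate
≍ ρℓ³ (BlockOccupationLD), while the compact phase is a (3+1)-D lattice field at diverging stiffness
with only irrelevant couplings left
(Popov; PistolesiEtAl2004 §IV; DupuisRancon2011 §4 — the phase–amplitude expansion is IR-finite term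
by term, the recorded scope caveat (ii) of
Literature.Barriers.AtomisticToContinuum.BogoliubovPerturbationInfraredNarrow), instead of
BFKT2017's strictly renormalisable Cartesian
'elliptic regime' (arXiv:1609.00968 §1.3) with its open large-field problem (route BECRenormGroup).
Imported area: constructive lattice
statistical mechanics — block-spin RG for massless lattice models approached along irrelevant
directions (GawedzkiKupiainen1980,
GawedzkiKupiainen1985), low-temperature expansions of N-vector models (Balaban1995,
BalabanOcarroll1999, GiulianiOtt2025) and vortex
energy–entropy bounds (FrohlichSpencerCMP1982, KennedyKing1986), distilled into ONE typed engine
statement (StiffPhaseLRO) that provers can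
attack without any Bose-gas input. Versus the sibling block route BECVortexSheetDuality (exact
Villain integer currents + duality/Peierls,
needs POSITIVE bondwise-Villain cell weights): here the delivered lattice model may carry a generic
small local remainder of either sign —
a weaker reduction target paid for by a harder engine. Negatives index: empty at filing.

RANKED CRUXES. #0 BlockPhaseCoherence (target) — uniform mesoscopic phase coherence on the torus:
for every repulsive finite-range v there is ρ₀ > 0 such that for 0 < ρ < ρ₀ there are c > 0 and a
block window 0 < ℓ₀, 2ℓ₀ ≤ ℓ₁ with: for all large N there is δ > 0 such that every periodic trial
state Ψ on the torus of side L = (N/ρ)^(1/3) with periodicEnergy ≤ E₀^per + δ satisfies, for every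
block number m with ℓ = L/m ∈ [ℓ₀, ℓ₁] and every pair of blocks z, z' (normalised block modes φ_z =
ℓ^(−3/2)·1_block), occ(φ_z + φ_z') ≥ occ(φ_z) + occ(φ_z') + 2cρℓ³ — the polarisation form of Re⟨φ_z,
γ_Ψ φ_z'⟩ ≥ cρℓ³ (z = z' is block condensation ≥ cρℓ³). What the card's mechanism delivers; strictly
stronger than PeriodicBEC (pairwise, not averaged). (why it might fail: Stronger than the open
PeriodicBEC (uniform over all block pairs at distance up to L); needs δ below the block Josephson
energy ≍ ρℓ so that no near-minimiser hides a phase-twisted region; v ≡ 0 gives equality with c =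
1/2.) [LiebSeiringerSolovejYngvason2005, Fournais2020, Junge2026,
Summits/AtomisticToContinuum/BoseEinsteinCondensation/Ideas/popov-polar-blocking-irrelevant-rg.md]
#2 StiffPhaseLRO (crux) — ENGINE (card item (c), the Gawedzki–Kupiainen × Fröhlich–Spencer marriage,
stated as one theorem). For every Λ ≥ 1 and range R there are ε₀, K₀, C > 0 such that for all K ≥
K₀, all m, n, all measurable, even, 2π-periodic bond potentials U_i (i ∈ Fin 4: three spatial, one
temporal) with K(1 − cos η) ≤ U_i(η) ≤ ΛK(1 − cos η), and every family of local terms w_x(θ)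
(depending only on θ restricted to the R-ball of x, 2π-periodic in each angle, measurable, |w_x(θ)|
≤ ε₀K Σ_(y ∈ R-ball of x) e_y(θ), e_y = forward XY energy density), the Gibbs measure ∝ exp(−Σ_x[Σ_i
U_i(∇_iθ_x) + w_x(θ)]) on [0,2π)^((Fin 3 → Fin(m+2)) × Fin(n+2)) has (1 − C/K)·Z ≤ ∫cos(θ_x −
θ_y)e^(−H) for all equal-time pairs x, y. Villain and cosine bonds are members (Λ = π²/4);
wrong-sign quartic gradient couplings are members; no reflection positivity, no positive-definite
bond weights assumed. [difficulty: open-problem] (why it might fail: Contains LRO-without-RP for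
perturbed XY (open): Ginibre fails for wrong-sign w, FS82/Kennedy–King duality needs
positive-definite bond weights, Balaban's RG is written only for the exact N-vector model; a
sandwiched U non-convex at scale K^(−1/2) (Biskup–Kotecký-type coexistence) is untested.)
[FrohlichSpencerCMP1982, GawedzkiKupiainen1980, GawedzkiKupiainen1985, Balaban1995,
BalabanOcarroll1999, GiulianiOtt2025, KennedyKing1986, GarbanSpencer2022, DarioGarban2025,
FrohlichSimonSpencer1976, BiskupKotecky2007]
#3 PolarTransfer (crux) — THE BET (card items (a)+(4), conditional so that the assembly is pure
logic): StiffPhaseLRO ⇒ BlockPhaseCoherence. Intended proof: for ρ < ρ₀ fix ℓ =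
C_L(ρa³)^(−δ')(ρa)^(−1/2) in the Fournais window (block condensation:
Fournais2020_condensation_holds; block energies: LSSY2005_lowerBound_neumann_holds /
LSSY2005_upperBound_periodic_holds), m = L/ℓ → ∞, time slabs τ₀ ≍ ℓξ (isotropic point of Josephson
E_J ≍ ρℓ and charging E_C ≍ 8πa/ℓ³); write the ground state (β → ∞ at fixed N, L, then
δ-near-minimisers via the fixed-(N,L) spectral gap) in block number–phase variables: integrating the
block numbers n_B EXACTLY gives real Villain-type temporal bonds, inter-block hopping gives
cosine-type spatial bonds, stiffness K ≍ (ℓ/ξ)²(ρa³)^(−1/2) → ∞; show the remainder is a local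
range-R term dominated by (ρa³)^η·K·(local XY energy) (small-amplitude blocks handled by
BlockOccupationLD), i.e. the delivered measure is in the class of StiffPhaseLRO with Λ = O(1); then
⟨cos(θ_B − θ_B')⟩ ≥ 1 − C/K and √(n_B n_B') ≥ ρℓ³(1 − O(√(ρa³))) give pairwise block coherence ≥
cρℓ³. [deps: StiffPhaseLRO, BlockOccupationLD] [difficulty: open-problem] (why it might fail:
Integrating block densities leaves the Berry term i·n_B∂τθ_B: unless the number–phase representation
absorbs it exactly the weights are complex and outside the class (BFKT's large-field problem
returns); the remainder may be exponentially, not finitely, ranged; θ_B needs n_B > 0 pathwise.)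
[arXiv:1609.00968, BFKT2017, BalabanEtAl2010, Benfatto1994, PistolesiEtAl2004, DupuisRancon2011,
Fournais2020, FournaisSolovej2020, LiebSeiringerYngvason2005,
Literature.Barriers.AtomisticToContinuum.BogoliubovPerturbationInfraredNarrow]
#4 BlockOccupationLD (crux) — amplitude zeros are large deviations (card item (b)): for every
repulsive finite-range v there is ρ₀ > 0 such that for 0 < ρ < ρ₀ and every deficit fraction η ∈
(0,1) there are c, ℓ₀ > 0 with: for all large N there is δ > 0 such that for every δ-near-minimiser
Ψ of the periodic energy on the torus of side L = (N/ρ)^(1/3), every block number m with ℓ = L/m ≥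
ℓ₀ and every block z, the |Ψ|²-probability (on the fundamental cell) that block z holds at most (1 −
η)ρℓ³ particles is ≤ exp(−cρℓ³). Volume-order (Poisson-strength) lower tail; v ≡ 0 is the binomial
tail with c < h(η) = η + (1−η)log(1−η). [difficulty: L] (why it might fail: The true lower-tail rate
of a superfluid ground state is unknown: phonon-dominated number fluctuations Var N_B ∝ ℓ² log ℓ
(Astrakharchik–Combescot–Pitaevskii) and a cavity may cost only surface energy, suggesting exp(−cℓ²)
not exp(−cρℓ³); near-minimisers need δ below the finite-N gap.)
[AstrakharchikCombescotPitaevskii2007, KlawunnEtAl2011, TorquatoStillinger2003,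
LiebSeiringerSolovejYngvason2005, FournaisSolovej2020]
#5 BoundaryTransferWeak (crux) — SHARED verbatim with routes BECPeriodicReduction and
BECVortexSheetDuality (stmt-AtomisticToContinuum-0827; one proof serves all): for each repulsive
finite-range v, PeriodicBEC(v) ⇒ ∃ρ₀ > 0 ∀ρ ∈ (0,ρ₀) HasGroundStateBEC v ρ (Dirichlet ground state,
mode-free λ_max(γ) ≥ cN via condensateNumber). Expected route: Neumann bracketing of interior
sub-boxes + a mode-free criterion; owned by BECPeriodicReduction. [deps: PolarTransfer] [difficulty:
L] (why it might fail: PeriodicBEC(v) is ground-state-only at the box (N/ρ)^(1/3): the Dirichlet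
ground state is a periodic trial state but lies a wall term ≫ δ above E₀^per and interior
restrictions are neither periodic nor of sharp N, so the hypothesis may never fire; BEC is
BC-sensitive (Robinson1976).) [LiebSeiringerSolovejYngvason2005, Junge2026, Basti2022,
BoccatoSeiringer2023, Robinson1976, LauwersVerbeureZagrebnov2003]
#9 QuarticPerturbedXYLRO (support) — MILESTONE 0 of the engine (the Λ = 1, R = 0 member that already
defeats every printed method): the (3+1)-torus XY model with cosine bonds of stiffness K plus ONE
site-local perturbation W of the four forward gradients, measurable, 2π-periodic, |W(η,τ)| ≤
ε₀K(Σ_i(1 − cos η_i)² + (1 − cos τ)²) (quartic at zero, mixed directions, either sign — not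
reflection positive, not Ginibre), has equal-time ⟨cos(θ_x − θ_y)⟩ ≥ 1 − C/K for K ≥ K₀, all m, n. A
prover may land it as a Literature fact under Literature/Probability/LatticeModels and cite it here;
StiffPhaseLRO with (Λ, R, ε₀) = (1, 0, ε₀/2) contains it. [difficulty: XL] [FrohlichSpencerCMP1982,
GarbanSpencer2022, BalabanOcarroll1999, GawedzkiKupiainen1980]
#9 BlockCoherenceToPeriodicBEC (support) — GLUE: BlockPhaseCoherence ⇒ PeriodicBEC (conclusion
verbatim the body of BECPeriodicReduction.PeriodicBEC, stmt-AtomisticToContinuum-0826). Proof: for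
large N pick m with L/m ∈ [ℓ₀, ℓ₁] (possible since 2ℓ₀ ≤ ℓ₁ and L → ∞); constantMode L = m^(−3/2)
Σ_z φ_z a.e., occupation is a nonnegative quadratic form in the mode (Fubini on the bounded cell
against a C¹ Ψ), so condensateOccupation = m^(−3) Σ_(z,z') Re⟨φ_z, γφ_z'⟩ ≥ m^(−3)·m³(m³ −
1)·cρ(L/m)³ ≥ (c/2)ρL³ = (c/2)N for m ≥ 2. [difficulty: M] [Fournais2020,
LiebSeiringerSolovejYngvason2005]

TWO-LAYER PLAN. Foreseen glued splits (none filed now; k ≤ 3, depth 1). PolarTransfer ⇐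
RealPolarRepresentation (the periodic gas at ρ < ρ₀, blocked at the Fournais
scale with time slabs τ₀ ≍ ℓξ, dominates block-pair coherences by n̄(1 − O(√(ρa³)))·⟨cos(θ_B −
θ_B')⟩ of an explicit REAL-weight compact-phase lattice
measure: Villain-type temporal bonds from exact block-number integration, cosine-type spatial bonds,
local remainder w) → RemainderInClass (sandwich
constant Λ = O(1), range R, |w| ≤ (ρa³)^η K e_loc, using BlockOccupationLD for low-amplitude blocks;
if the delivered remainder is only exponentially
local, the engine is widened by `--resplit` rather than the remainder truncated) → PolarTransfer.
StiffPhaseLRO ⇐ QuarticPerturbedXYLRO (support,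
filed) → SandwichExtension (from the site-local quartic member to the (Λ, R) class by the same
expansion) → StiffPhaseLRO. BlockOccupationLD ⇐ ground-state
version (exact Ψ₀, uniform in L) → near-minimiser stability via the fixed-(N,L) spectral gap →
BlockOccupationLD. BoundaryTransferWeak: owned by
BECPeriodicReduction, not split here.

KILL CRITERIA. K1: StiffPhaseLRO refuted by an explicit (U, w) in the class (equal-time order → 0 at
arbitrarily large K for some Λ, R) ⇒ restate with the structure the
delivered model actually has (ferromagnetic-sign or quartic-only remainder; Λ = 1 + o(1)) — or close
refuted:StiffPhaseLRO if even QuarticPerturbedXYLRO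
dies. K2: the cheapest falsifier below shows that the block effective action keeps a complex
(Berry-phase) part of relative size O(1) at every
admissible blocking point, so no real-weight member of the class is delivered ⇒ PolarTransfer is
back in BFKT's complex large-field class; close as
superseded by route BECRenormGroup (the card's own 'collapses back onto BECRenormGroup'). K3:
BlockOccupationLD refuted (rate genuinely sub-volume,
e.g. exp(−cℓ²)) ⇒ amplitude zeros are not rare enough for a Peierls bound on low-amplitude blocks;
pivot PolarTransfer to a vortex-DENSITY (not
vortex-exclusion) argument or close. K4: BlockPhaseCoherence refuted for some admissible v at
arbitrarily small ρ kills this route and every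
block-phase card (sync-instead-of-rp, integer-block-rotor-rp, coherence-angle-scale-chaining,
vortex-sheet-duality). K5: ¬BoundaryTransferWeak kills
the route, not the conjunct (shared with BECPeriodicReduction). PeriodicBEC proved by any route
moots PolarTransfer's role in the assembly (the engine
and BlockPhaseCoherence keep independent value).

NOT DECOMPOSED YET. The imaginary-time / Trotter representation of the blocked gas as a Lean object
(PolarTransfer's prover builds what is needed under Theorems; a
definition request is filed only once the representation is fixed — number–phase vs coherent
states); the time-continuum limit (deliberately
avoided: blocking time at τ₀ ≍ ℓξ keeps the lattice isotropic; the quantum-rotor limit K_t/K_s → ∞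
is card integer-block-rotor-rp's territory);
the constants (Fournais exponents δ' < 1/34-type bookkeeping, ε₀(Λ,R), K₀); positive temperature;
general dimension of the engine (only the
(3+1)-torus is typed); the Dirichlet-box version of the blocking (BoundaryTransferWeak is consumed
as a black box).

CHEAPEST FALSIFIER. One-loop symbolic computation of the BLOCK effective action (the card's fastest
refutation, sharpened): block the Bogoliubov/Popov action at
ℓ = ξ(ρa³)^(−ε'), τ₀ = ℓξ, integrate δn_B; list every generated coupling with its power of K ≍
(ℓ/ξ)²(ρa³)^(−1/2) and of (ρa³). The line dies
if (i) the cubic Berry term i(∂τθ)(∇θ)² or any other IMAGINARY coupling survives with a coefficient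
that is not o(1)·K·e_loc at the isotropic
blocking point (complex weights ⇒ outside StiffPhaseLRO), or (ii) a real coupling not dominated by
ε·K·(local XY energy) with ε → 0 as ρ → 0
appears (e.g. a K-independent (∂τθ)²(∇θ)² or kernels decaying slower than summably in block
distance). Not run here (no kit in plancard mode);
it is a half-page computation for a refuter. Second-cheapest: a Monte-Carlo sanity check of
QuarticPerturbedXYLRO's wrong-sign member on 8⁴–16⁴ tori at K = 1…4.

NUMBERS. Fournais window: ℓ = C_L(ρa³)^(−δ')(ρa)^(−1/2), condensation for ⟨Ψ,HΨ⟩ ≤ 4πaρN +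
C₀aρ(ρa³)^(1/2−ε)N when 2δ' + ε < 1/2 (Fournais2020 Thm 1.2 =
Fournais2020_condensation, proved in tree); healing length ξ = (8πρa)^(−1/2); Josephson E_J ≍ ρℓ,
charging E_C ≍ 8πa/ℓ³, isotropic slab τ₀ =
(E_J E_C)^(−1/2) = ℓξ; stiffness K = E_Jτ₀ ≍ (ℓ/ξ)²·ρξ³ ∝ (ℓ/ξ)²(ρa³)^(−1/2) → ∞; mean block
occupation n̄ = ρℓ³ ∝ (ρa³)^(−1/2−3δ') ≫ 1; expected
depletion O(√(ρa³)) (LHY: 1 + (128/15√π)√(ρa³), FournaisSolovej2020); LD rate cρℓ³ = c·n̄ with c <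
h(η) = η + (1−η)log(1−η) (binomial benchmark,
v ≡ 0); 3-D XY ordering threshold β_c ≈ 0.454 (so K₀ ≳ 1/2 even in the thinnest slab); power
counting in 3+1, z = 1: (∂τθ)(∇θ)² dimension 6 > 4,
(∇θ)⁴ dimension 8 > 4 (irrelevant), cf. BogoliubovPerturbationInfraredNarrow conjunct (2) with s =
2. Items at open: 8 (1 target, 4 cruxes, 2 support, 1 assembly).

DEFINITION REQUESTS. None filed now: block modes, block sets and the lattice Hamiltonians are
inlined in the statements (EuclideanSpace/Set.indicator/Finset sums over
(Fin 3 → Fin (m+2)) × Fin (n+2));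
Literature.MathematicalPhysics.QuantumManyBody.BoseGas.{PeriodicTrialState, periodicEnergy,
periodicGroundStateEnergy,
cellOccupation, condensateOccupation, cellN, Config, sideLength, IsRepulsiveFiniteRange,
HasGroundStateBEC, BoseEinsteinCondensation} all exist
(lean search --decl). A `blockMode`/`blockCoherence` API in PeriodicBoseGas.lean would shorten
BlockPhaseCoherence/BlockOccupationLD and is worth a
definition item once a second block route wants it.

Novelty: Searches (2026-08-15): `lit frontier AtomisticToContinuum --since 2020` (30 rows; BEC descendants
arXiv:2603.20776, arXiv:2510.20493, arXiv:2602.16566 —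
none on polar/hydrodynamic RG); `lit bridges AtomisticToContinuum --cross any` (30 rows, no Bose-gas
× lattice-spin bridge); `lit search --source crossref`
"low temperature expansion classical N-vector models Balaban" (7 hits: doi:10.1007/bf02099355,
doi:10.1007/bf02506422, doi:10.1007/s002200050433,
doi:10.1007/s002200050510, doi:10.2140/pmp.2025.6.439), "Dario Garban … Villain reflection
positivity" (0 relevant), "Garban Spencer continuous symmetry
breaking Nishimori" (FSS1976 only); `lit vsearch` "long range order for the XY model at low
temperature without reflection positivity" (5 book hits,
FriedliVelenik2017 ch. 9–10 only); `lit read` arXiv:2302.07299 (GiulianiOtt2025) p.3 and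
arXiv:2311.16546 (DarioGarban2025) pp.5,7,35; local FTS daemon
and OpenAlex/arXiv APIs were unavailable (connection reset / HTTP 429) in this pass — recorded in
NOTES.md; `lean search` for Villain/rotator decls (found the
sibling route BECVortexSheetDuality and
Literature.MathematicalPhysics.QuantumFieldTheory.U1Villain*); `ledger idea list` (115 cards; no
routed polar-RG card);
`ledger negatives` (0).
Nearest prior art found: BFKT2017 = arXiv:1609.00968 §1.3 (announced Cartesian 'elliptic regime' RG
to the symmetry-broken fixed point, large fields
deferred) and BalabanEtAl2010 (route BECRenormGroup); Balaban1995/BalabanOcarroll1999 (block RG wit  [refs: 10.1007/bf02099355, 10.1007/bf02506422, 10.1007/s002200050433, 10.1007/s002200050510, 10.2140/pmp.2025.6.439, 2603.20776, 2510.20493, 2602.16566, 2302.07299, 2311.16546, 1609.00968, doi:10.1007/bf02099355, doi:10.1007/bf02506422, doi:10.1007/s002200050433, doi:10.1007/s002200050510, doi:10.2140/pmp.2025.6.439, FriedliVelenik2017, GiulianiOtt2025, DarioGarban2025, BFKT2017, BalabanEtAl2010, Balaban]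

Barriers (technique_class: polar-variables block-spin-rg irrelevant-operators): - technique_class: polar-variables block-spin-rg irrelevant-operators
- Literature.Barriers.AtomisticToContinuum.BogoliubovPerturbationInfrared: evaded by construction —
no expansion in the particle (Cartesian) representation; the Goldstone field enters only through
gradients (vertex order s = 2, finite in d = 3 by BogoliubovPerturbationInfraredNarrow conjunct
(2)); residual honesty: convergence (not n!-asymptotics) is exactly what StiffPhaseLRO must supply.
- Literature.Barriers.AtomisticToContinuum.BogoliubovPerturbationInfraredNarrow: its scope caveat
(ii) (phase–amplitude expansions IR-finite term by term) is the route; what it leaves — the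
large-field problem — is relocated into BlockOccupationLD (amplitude zeros as large deviations) and
the vortex part of the engine.
- Literature.Barriers.AtomisticToContinuum.KineticGapLengthScales: respected — the kinetic gap is
used only INSIDE blocks of side ℓ ≤ ξ(ρa³)^(−ε') (Fournais window, where it is a theorem);
inter-block coherence comes from the gap-free lattice engine.
- Literature.Barriers.AtomisticToContinuum.KineticGapLengthScalesNarrow: BlockPhaseCoherence /
PeriodicBEC are energy-window statements, but with δ chosen AFTER N (∃δ, allowed to be far below the
boost cost 4π²N/L²), so the Galilei-boost witnesses do not fire; and the proof is not 'depletion ≤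
gap⁻¹ × energy excess' but a representation + correlation argument on Ψ₀, transferred to
near-minimisers by the fixed-(N,L) spectral gap (exit (a)/(b) of the narrowing).

History (route lifecycle, newest last):
- 2026-08-15T13:39:49Z · CLOSED retired — not-a-thesis: assembly does not conclude the sub-problem Statement (operator:999:1257524)

sub-problem: BoseEinsteinCondensation · status: closed(retired) · opened planner-plancard-AtomisticToContinuum-BoseEin-5451e747-0 2026-08-15T11:42:48Z · rev 0 · ledger route-AtomisticToContinuum-BECPolarBlockRG
GENERATED by the gate from the ledger (D-0016/17). Provers cite these decls: `theorem foo : Summit.AtomisticToContinuum.BoseEinsteinCondensation.Theses.BECPolarBlockRG.<Decl> := …` in Summits/AtomisticToContinuum/BoseEinsteinCondensation/Theorems/<Name>.lean.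
-/

namespace Summit.AtomisticToContinuum.BoseEinsteinCondensation.Theses.BECPolarBlockRG

open scoped BigOperators Topology Manifold Classical MeasureTheory ProbabilityTheory Matrix InnerProductSpace ComplexConjugate ContinuousMap
open Filter Set Function TopologicalSpace MeasureTheory

attribute [summit_statement] _root_.BoseEinsteinCondensation

/-- item stmt-AtomisticToContinuum-5819 · target · rank 0 · closed · moot by None · by planner
why it might fail: Stronger than the open PeriodicBEC (uniform over all block pairs at distance up to L); needs δ below the block Josephson energy ≍ ρℓ so that no near-minimiser hides a phase-twisted region; v ≡ 0 gives equality with c = 1/2.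
sources: LiebSeiringerSolovejYngvason2005, Fournais2020, Junge2026, Summits/AtomisticToContinuum/BoseEinsteinCondensation/Ideas/popov-polar-blocking-irrelevant-rg.md
[target] uniform mesoscopic phase coherence on the torus: for every repulsive finite-range v there
is ρ₀ > 0 such that for 0 < ρ < ρ₀ there are c > 0 and a block window 0 < ℓ₀, 2ℓ₀ ≤ ℓ₁ with: for all
large N there is δ > 0 such that every periodic trial state Ψ on the torus of side L = (N/ρ)^(1/3)
with periodicEnergy ≤ E₀^per + δ satisfies, for every block number m with ℓ = L/m ∈ [ℓ₀, ℓ₁] and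
every pair of blocks z, z' (normalised block modes φ_z = ℓ^(−3/2)·1_block), occ(φ_z + φ_z') ≥
occ(φ_z) + occ(φ_z') + 2cρℓ³ — the polarisation form of Re⟨φ_z, γ_Ψ φ_z'⟩ ≥ cρℓ³ (z = z' is block
condensation ≥ cρℓ³). What the card's mechanism delivers; strictly stronger than PeriodicBEC
(pairwise, not averaged). -/
@[route_item "route-AtomisticToContinuum-BECPolarBlockRG"]
def BlockPhaseCoherence : Prop :=
  ∀ v : ℝ → ENNReal, Literature.MathematicalPhysics.QuantumManyBody.BoseGas.IsRepulsiveFiniteRange v → ∃ ρ₀ : ℝ, 0 < ρ₀ ∧ ∀ ρ : ℝ, 0 < ρ → ρ < ρ₀ → ∃ c ℓ₀ ℓ₁ : ℝ, 0 < c ∧ 0 < ℓ₀ ∧ 2 * ℓ₀ ≤ ℓ₁ ∧ ∀ᶠ N : ℕ in Filter.atTop, ∃ δ : ENNReal, 0 < δ ∧ ∀ Ψ : Literature.MathematicalPhysics.QuantumManyBody.BoseGas.PeriodicTrialState N (Literature.MathematicalPhysics.QuantumManyBody.BoseGas.sideLength ρ N), Literature.MathematicalPhysics.QuantumManyBody.BoseGas.periodicEnergy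 v Ψ ≤ Literature.MathematicalPhysics.QuantumManyBody.BoseGas.periodicGroundStateEnergy v N (Literature.MathematicalPhysics.QuantumManyBody.BoseGas.sideLength ρ N) + δ → ∀ m : ℕ, 0 < m → let L := Literature.MathematicalPhysics.QuantumManyBody.BoseGas.sideLength ρ N; let ℓ := L / m; ℓ₀ ≤ ℓ → ℓ ≤ ℓ₁ → let φ : (Fin 3 → Fin m) → EuclideanSpace ℝ (Fin 3) → ℂ := fun z => ({x : EuclideanSpace ℝ (Fin 3) | ∀ k, x k ∈ Set.Ico (((z k : ℕ) : ℝ) * ℓ) ((((z k : ℕ) : ℝ) + 1) * ℓ)}).indicator (fun _ => ((Real.sqrt (ℓ ^ 3))⁻¹ : ℂ)); ∀ z z' : Fin 3 → Fin m, Literature.MathematicalPhysics.QuantumManyBody.BoseGas.cellOccupation N L (φ z) Ψ.ψ + Literature.MathematicalPhysics.QuantumManyBody.BoseGas.cellOccupation N L (φ z') Ψ.ψ + ENNReal.ofReal (2 * c * ρ * ℓ ^ 3) ≤ Literature.MathematicalPhysics.QuantumManyBody.BoseGas.cellOccupation N L (fun x => φ z x + φ z' x) Ψ.ψ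

/-- item stmt-AtomisticToContinuum-5820 · crux · rank 2 · closed · moot by None · by planner
why it might fail: Contains LRO-without-RP for perturbed XY (open): Ginibre fails for wrong-sign w, FS82/Kennedy–King duality needs positive-definite bond weights, Balaban's RG is written only for the exact N-vector model; a sandwiched U non-convex at scale K^(−1/2) (Biskup–Kotecký-type coexistence) is untested.
sources: FrohlichSpencerCMP1982, GawedzkiKupiainen1980, GawedzkiKupiainen1985, Balaban1995, BalabanOcarroll1999, GiulianiOtt2025
[crux] ENGINE (card item (c), the Gawedzki–Kupiainen × Fröhlich–Spencer marriage, stated as one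
theorem). For every Λ ≥ 1 and range R there are ε₀, K₀, C > 0 such that for all K ≥ K₀, all m, n,
all measurable, even, 2π-periodic bond potentials U_i (i ∈ Fin 4: three spatial, one temporal) with
K(1 − cos η) ≤ U_i(η) ≤ ΛK(1 − cos η), and every family of local terms w_x(θ) (depending only on θ
restricted to the R-ball of x, 2π-periodic in each angle, measurable, |w_x(θ)| ≤ ε₀K Σ_(y ∈ R-ball
of x) e_y(θ), e_y = forward XY energy density), the Gibbs measure ∝ exp(−Σ_x[Σ_i U_i(∇_iθ_x) +
w_x(θ)]) on [0,2π)^((Fin 3 → Fin(m+2)) × Fin(n+2)) has (1 − C/K)·Z ≤ ∫cos(θ_x − θ_y)e^(−H) for all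
equal-time pairs x, y. Villain and cosine bonds are members (Λ = π²/4); wrong-sign quartic gradient
couplings are members; no reflection positivity, no positive-definite bond weights assumed.
[difficulty: open-problem] -/
@[route_item "route-AtomisticToContinuum-BECPolarBlockRG"]
def StiffPhaseLRO : Prop :=
  ∀ Λ : ℝ, 1 ≤ Λ → ∀ R : ℕ, ∃ ε₀ K₀ C : ℝ, 0 < ε₀ ∧ 0 < K₀ ∧ 0 < C ∧ ∀ K : ℝ, K₀ ≤ K → ∀ m n : ℕ, ∀ U : Fin 4 → ℝ → ℝ, (∀ i, Measurable (U i)) → (∀ i η, U i (η + 2 * Real.pi) = U i η) → (∀ i η, U i (-η) = U i η) → (∀ i η, K * (1 - Real.cos η) ≤ U i η ∧ U i η ≤ Λ * K * (1 - Real.cos η)) → ∀ w : ((Fin 3 → Fin (m + 2)) × Fin (n + 2)) → (((Fin 3 → Fin (m + 2)) × Fin (n + 2)) → ℝ) → ℝ, (∀ x, Measurable (w x)) → (∀ x θ y, w x (θ + Pi.single y (2 * Real.pi)) = w x θ) → let near : ((Fin 3 → Fin (m + 2)) × Fin (n + 2)) → ((Fin 3 → Fin (m + 2)) × Fin (n +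 2)) → Prop := fun x y => (∀ i, ((y.1 i - x.1 i : Fin (m + 2)) : ℕ) ≤ R ∨ ((x.1 i - y.1 i : Fin (m + 2)) : ℕ) ≤ R) ∧ (((y.2 - x.2 : Fin (n + 2)) : ℕ) ≤ R ∨ ((x.2 - y.2 : Fin (n + 2)) : ℕ) ≤ R); let e : ((Fin 3 → Fin (m + 2)) × Fin (n + 2)) → (((Fin 3 → Fin (m + 2)) × Fin (n + 2)) → ℝ) → ℝ := fun s θ => (∑ i : Fin 3, (1 - Real.cos (θ (s.1 + Pi.single i 1, s.2) - θ s))) + (1 - Real.cos (θ (s.1, s.2 + 1) - θ s)); (∀ x θ θ', (∀ y, near x y → θ y = θ' y) → w x θ = w x θ') → (∀ x θ, |w x θ| ≤ ε₀ * K * ∑ y, if near x y then e y θ else 0) → let H : (((Fin 3 → Fin (m + 2)) × Fin (n + 2)) → ℝ) → ℝ := fun θ => ∑ s, ((∑ i : Fin 3, U (Fin.castSucc i) (θ (s.1 + Pi.single i 1, s.2) - θ s)) + U (Fin.last 3) (θ (s.1, s.2 + 1) - θ s) + w s θ); ∀ x y : ((Fin 3 → Fin (m + 2)) × Fin (n +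 2)), x.2 = y.2 → (1 - C / K) * ∫ θ in Set.pi Set.univ (fun _ : ((Fin 3 → Fin (m + 2)) × Fin (n + 2)) => Set.Ico (0 : ℝ) (2 * Real.pi)), Real.exp (-H θ) ≤ ∫ θ in Set.pi Set.univ (fun _ : ((Fin 3 → Fin (m + 2)) × Fin (n + 2)) => Set.Ico (0 : ℝ) (2 * Real.pi)), Real.cos (θ x - θ y) * Real.exp (-H θ)

/-- item stmt-AtomisticToContinuum-5821 · crux · rank 3 · closed · moot by None · by planner
why it might fail: Integrating block densities leaves the Berry term i·n_B∂τθ_B: unless the number–phase representation absorbs it exactly the weights are complex and outside the class (BFKT's large-field problem returns); the remainder may be exponentially, not finitely, ranged; θ_B needs n_B > 0 pathwise.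
sources: arXiv:1609.00968, BFKT2017, BalabanEtAl2010, Benfatto1994, PistolesiEtAl2004, DupuisRancon2011
[crux] THE BET (card items (a)+(4), conditional so that the assembly is pure logic): StiffPhaseLRO ⇒
BlockPhaseCoherence. Intended proof: for ρ < ρ₀ fix ℓ = C_L(ρa³)^(−δ')(ρa)^(−1/2) in the Fournais
window (block condensation: Fournais2020_condensation_holds; block energies:
LSSY2005_lowerBound_neumann_holds / LSSY2005_upperBound_periodic_holds), m = L/ℓ → ∞, time slabs τ₀
≍ ℓξ (isotropic point of Josephson E_J ≍ ρℓ and charging E_C ≍ 8πa/ℓ³); write the ground state (β →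
∞ at fixed N, L, then δ-near-minimisers via the fixed-(N,L) spectral gap) in block number–phase
variables: integrating the block numbers n_B EXACTLY gives real Villain-type temporal bonds,
inter-block hopping gives cosine-type spatial bonds, stiffness K ≍ (ℓ/ξ)²(ρa³)^(−1/2) → ∞; show the
remainder is a local range-R term dominated by (ρa³)^η·K·(local XY energy) (small-amplitude blocks
handled by BlockOccupationLD), i.e. the delivered measure is in the class of StiffPhaseLRO with Λ =
O(1); then ⟨cos(θ_B − θ_B')⟩ ≥ 1 − C/K and √(n_B n_B') ≥ ρℓ³(1 − O(√(ρa³))) give pairwise block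
coherence ≥ cρℓ³. [deps: StiffPhaseLRO, BlockOccupationLD] [difficulty: open-problem] -/
@[route_item "route-AtomisticToContinuum-BECPolarBlockRG"]
def PolarTransfer : Prop :=
  StiffPhaseLRO → ∀ v : ℝ → ENNReal, Literature.MathematicalPhysics.QuantumManyBody.BoseGas.IsRepulsiveFiniteRange v → ∃ ρ₀ : ℝ, 0 < ρ₀ ∧ ∀ ρ : ℝ, 0 < ρ → ρ < ρ₀ → ∃ c ℓ₀ ℓ₁ : ℝ, 0 < c ∧ 0 < ℓ₀ ∧ 2 * ℓ₀ ≤ ℓ₁ ∧ ∀ᶠ N : ℕ in Filter.atTop, ∃ δ : ENNReal, 0 < δ ∧ ∀ Ψ : Literature.MathematicalPhysics.QuantumManyBody.BoseGas.PeriodicTrialState N (Literature.MathematicalPhysics.QuantumManyBody.BoseGas.sideLength ρ N), Literature.MathematicalPhysics.QuantumManyBody.BoseGas.periodicEnergy v Ψ ≤ Literature.MathematicalPhysics.QuantumManyBody.BoseGas.periodicGroundStateEnergy v N (Literature.MathematicalPhysics.QuantumManyBody.BoseGas.sideLength ρ N) + δ → ∀ m : ℕ, 0 < m → let L := Literature.MathematicalPhysics.QuantumManyBody.BoseGas.sideLength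 ρ N; let ℓ := L / m; ℓ₀ ≤ ℓ → ℓ ≤ ℓ₁ → let φ : (Fin 3 → Fin m) → EuclideanSpace ℝ (Fin 3) → ℂ := fun z => ({x : EuclideanSpace ℝ (Fin 3) | ∀ k, x k ∈ Set.Ico (((z k : ℕ) : ℝ) * ℓ) ((((z k : ℕ) : ℝ) + 1) * ℓ)}).indicator (fun _ => ((Real.sqrt (ℓ ^ 3))⁻¹ : ℂ)); ∀ z z' : Fin 3 → Fin m, Literature.MathematicalPhysics.QuantumManyBody.BoseGas.cellOccupation N L (φ z) Ψ.ψ + Literature.MathematicalPhysics.QuantumManyBody.BoseGas.cellOccupation N L (φ z') Ψ.ψ + ENNReal.ofReal (2 * c * ρ * ℓ ^ 3) ≤ Literature.MathematicalPhysics.QuantumManyBody.BoseGas.cellOccupation N L (fun x => φ z x + φ z' x) Ψ.ψ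

/-- item stmt-AtomisticToContinuum-5822 · crux · rank 4 · closed · moot by None · by planner
why it might fail: The true lower-tail rate of a superfluid ground state is unknown: phonon-dominated number fluctuations Var N_B ∝ ℓ² log ℓ (Astrakharchik–Combescot–Pitaevskii) and a cavity may cost only surface energy, suggesting exp(−cℓ²) not exp(−cρℓ³); near-minimisers need δ below the finite-N gap.
sources: AstrakharchikCombescotPitaevskii2007, KlawunnEtAl2011, TorquatoStillinger2003, LiebSeiringerSolovejYngvason2005, FournaisSolovej2020
[crux] amplitude zeros are large deviations (card item (b)): for every repulsive finite-range v
there is ρ₀ > 0 such that for 0 < ρ < ρ₀ and every deficit fraction η ∈ (0,1) there are c, ℓ₀ > 0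
with: for all large N there is δ > 0 such that for every δ-near-minimiser Ψ of the periodic energy
on the torus of side L = (N/ρ)^(1/3), every block number m with ℓ = L/m ≥ ℓ₀ and every block z, the
|Ψ|²-probability (on the fundamental cell) that block z holds at most (1 − η)ρℓ³ particles is ≤
exp(−cρℓ³). Volume-order (Poisson-strength) lower tail; v ≡ 0 is the binomial tail with c < h(η) = η
+ (1−η)log(1−η). [difficulty: L] -/
@[route_item "route-AtomisticToContinuum-BECPolarBlockRG"]
def BlockOccupationLD : Prop :=
  ∀ v : ℝ → ENNReal, Literature.MathematicalPhysics.QuantumManyBody.BoseGas.IsRepulsiveFiniteRange v → ∃ ρ₀ : ℝ, 0 < ρ₀ ∧ ∀ ρ : ℝ, 0 < ρ → ρ < ρ₀ → ∀ η : ℝ, 0 < η → η < 1 → ∃ c ℓ₀ : ℝ, 0 < c ∧ 0 < ℓ₀ ∧ ∀ᶠ N : ℕ in Filter.atTop, ∃ δ : ENNReal, 0 < δ ∧ ∀ Ψ : Literature.MathematicalPhysics.QuantumManyBody.BoseGas.PeriodicTrialState N (Literature.MathematicalPhysics.QuantumManyBody.BoseGas.sideLength ρ N), Literature.MathematicalPhysics.QuantumManyBody.BoseGas.periodicEnergy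 v Ψ ≤ Literature.MathematicalPhysics.QuantumManyBody.BoseGas.periodicGroundStateEnergy v N (Literature.MathematicalPhysics.QuantumManyBody.BoseGas.sideLength ρ N) + δ → ∀ m : ℕ, 0 < m → let L := Literature.MathematicalPhysics.QuantumManyBody.BoseGas.sideLength ρ N; let ℓ := L / m; ℓ₀ ≤ ℓ → ∀ z : Fin 3 → Fin m, ∫⁻ X in {X : Literature.MathematicalPhysics.QuantumManyBody.BoseGas.Config N | X ∈ Literature.MathematicalPhysics.QuantumManyBody.BoseGas.cellN N L ∧ (∑ i, ({x : EuclideanSpace ℝ (Fin 3) | ∀ k, x k ∈ Set.Ico (((z k : ℕ) : ℝ) * ℓ) ((((z k : ℕ) : ℝ) + 1) * ℓ)}).indicator (fun _ => (1 : ℝ)) (X i)) ≤ (1 - η) * ρ * ℓ ^ 3}, (‖Ψ.ψ X‖₊ : ENNReal) ^ 2 ≤ ENNReal.ofReal (Real.exp (-(c * ρ * ℓ ^ 3)))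

/-- item stmt-AtomisticToContinuum-0827 · crux · rank 5 · open · by planner
why it might fail: PeriodicBEC(v) is ground-state-only at the box (N/ρ)^(1/3): the Dirichlet ground state is a periodic trial state but lies a wall term ≫ δ above E₀^per and interior restrictions are neither periodic nor of sharp N, so the hypothesis may never fire; BEC is BC-sensitive (Robinson1976).
sources: LiebSeiringerSolovejYngvason2005, Junge2026, Basti2022, BoccatoSeiringer2023, Robinson1976, LauwersVerbeureZagrebnov2003
[crux] BoundaryTransferWeak (mode-free boundary-condition transfer, per potential): for each
repulsive finite-range v, PeriodicBEC(v) implies ∃ρ₀>0 ∀ρ∈(0,ρ₀) HasGroundStateBEC v ρ (Dirichlet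
ground state, λ_max(γ) ≥ cN via condensateNumber). Not glue: near-minimiser slacks are O(N/L²) while
Dirichlet/periodic energies differ by a boundary term ≫ N/L², so no energy-comparison proof;
expected route: Neumann bracketing of interior sub-boxes (−Δ_Dir ≥ ⊕−Δ_Neu, v ≥ 0) + a mode-free
criterion (λ_max ≥ tr γ²/N). Only the ENERGY analogue is in print (LiebSeiringerSolovejYngvason2005
Ch. 2 after (2.8)). v ≡ 0: hypothesis and conclusion both true. -/
@[route_item "route-AtomisticToContinuum-BECPolarBlockRG"]
def BoundaryTransferWeak : Prop :=
  ∀ v : ℝ → ENNReal, Literature.MathematicalPhysics.QuantumManyBody.BoseGas.IsRepulsiveFiniteRange v → (∃ ρ₀ : ℝ, 0 < ρ₀ ∧ ∀ ρ : ℝ, 0 < ρ → ρ < ρ₀ → ∃ c : ℝ, 0 < c ∧ ∀ᶠ N : ℕ in Filter.atTop, ∃ δ : ENNReal, 0 < δ ∧ ∀ Ψ : Literature.MathematicalPhysics.QuantumManyBody.BoseGas.PeriodicTrialState N (Literature.MathematicalPhysics.QuantumManyBody.BoseGas.sideLength ρ N), Literature.MathematicalPhysics.QuantumManyBody.BoseGas.periodicEnergy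 v Ψ ≤ Literature.MathematicalPhysics.QuantumManyBody.BoseGas.periodicGroundStateEnergy v N (Literature.MathematicalPhysics.QuantumManyBody.BoseGas.sideLength ρ N) + δ → ENNReal.ofReal (c * N) ≤ Literature.MathematicalPhysics.QuantumManyBody.BoseGas.condensateOccupation N (Literature.MathematicalPhysics.QuantumManyBody.BoseGas.sideLength ρ N) Ψ.ψ) → ∃ ρ₀ : ℝ, 0 < ρ₀ ∧ ∀ ρ : ℝ, 0 < ρ → ρ < ρ₀ → Literature.MathematicalPhysics.QuantumManyBody.BoseGas.HasGroundStateBEC v ρ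

/-- item stmt-AtomisticToContinuum-5823 · support · rank 9 · closed · moot by None · by planner
sources: FrohlichSpencerCMP1982, GarbanSpencer2022, BalabanOcarroll1999, GawedzkiKupiainen1980
[support] MILESTONE 0 of the engine (the Λ = 1, R = 0 member that already defeats every printed
method): the (3+1)-torus XY model with cosine bonds of stiffness K plus ONE site-local perturbation
W of the four forward gradients, measurable, 2π-periodic, |W(η,τ)| ≤ ε₀K(Σ_i(1 − cos η_i)² + (1 −
cos τ)²) (quartic at zero, mixed directions, either sign — not reflection positive, not Ginibre),
has equal-time ⟨cos(θ_x − θ_y)⟩ ≥ 1 − C/K for K ≥ K₀, all m, n. A prover may land it as a Literature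
fact under Literature/Probability/LatticeModels and cite it here; StiffPhaseLRO with (Λ, R, ε₀) =
(1, 0, ε₀/2) contains it. [difficulty: XL] -/
@[route_item "route-AtomisticToContinuum-BECPolarBlockRG"]
def QuarticPerturbedXYLRO : Prop :=
  ∃ ε₀ K₀ C : ℝ, 0 < ε₀ ∧ 0 < K₀ ∧ 0 < C ∧ ∀ K : ℝ, K₀ ≤ K → ∀ m n : ℕ, ∀ W : (Fin 3 → ℝ) → ℝ → ℝ, Measurable (fun p : (Fin 3 → ℝ) × ℝ => W p.1 p.2) → (∀ η τ, |W η τ| ≤ ε₀ * K * ((∑ i, (1 - Real.cos (η i)) ^ 2) + (1 - Real.cos τ) ^ 2)) → (∀ η τ, ∀ i : Fin 3, W (η + Pi.single i (2 * Real.pi)) τ = W η τ) → (∀ η τ, W η (τ + 2 * Real.pi) = W η τ) → let H : (((Fin 3 → Fin (m + 2)) × Fin (n + 2)) → ℝ) → ℝ := fun θ : ((Fin 3 → Fin (m + 2)) × Fin (n + 2)) → ℝ => ∑ s : ((Fin 3 → Fin (m + 2)) × Fin (n + 2)), (-(K * ((∑ i : Fin 3, Real.cos (θ (s.1 + Pi.single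 i 1, s.2) - θ s)) + Real.cos (θ (s.1, s.2 + 1) - θ s))) + W (fun i : Fin 3 => θ (s.1 + Pi.single i 1, s.2) - θ s) (θ (s.1, s.2 + 1) - θ s)); ∀ x y : ((Fin 3 → Fin (m + 2)) × Fin (n + 2)), x.2 = y.2 → (1 - C / K) * ∫ θ in Set.pi Set.univ (fun _ : ((Fin 3 → Fin (m + 2)) × Fin (n + 2)) => Set.Ico (0 : ℝ) (2 * Real.pi)), Real.exp (-H θ) ≤ ∫ θ in Set.pi Set.univ (fun _ : ((Fin 3 → Fin (m + 2)) × Fin (n + 2)) => Set.Ico (0 : ℝ) (2 * Real.pi)), Real.cos (θ x - θ y) * Real.exp (-H θ)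

/-- item stmt-AtomisticToContinuum-5824 · support · rank 9 · closed · moot by None · by planner
sources: Fournais2020, LiebSeiringerSolovejYngvason2005
[support] GLUE: BlockPhaseCoherence ⇒ PeriodicBEC (conclusion verbatim the body of
BECPeriodicReduction.PeriodicBEC, stmt-AtomisticToContinuum-0826). Proof: for large N pick m with
L/m ∈ [ℓ₀, ℓ₁] (possible since 2ℓ₀ ≤ ℓ₁ and L → ∞); constantMode L = m^(−3/2) Σ_z φ_z a.e.,
occupation is a nonnegative quadratic form in the mode (Fubini on the bounded cell against a C¹ Ψ),
so condensateOccupation = m^(−3) Σ_(z,z') Re⟨φ_z, γφ_z'⟩ ≥ m^(−3)·m³(m³ − 1)·cρ(L/m)³ ≥ (c/2)ρL³ =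
(c/2)N for m ≥ 2. [difficulty: M] -/
@[route_item "route-AtomisticToContinuum-BECPolarBlockRG"]
def BlockCoherenceToPeriodicBEC : Prop :=
  (∀ v : ℝ → ENNReal, Literature.MathematicalPhysics.QuantumManyBody.BoseGas.IsRepulsiveFiniteRange v → ∃ ρ₀ : ℝ, 0 < ρ₀ ∧ ∀ ρ : ℝ, 0 < ρ → ρ < ρ₀ → ∃ c ℓ₀ ℓ₁ : ℝ, 0 < c ∧ 0 < ℓ₀ ∧ 2 * ℓ₀ ≤ ℓ₁ ∧ ∀ᶠ N : ℕ in Filter.atTop, ∃ δ : ENNReal, 0 < δ ∧ ∀ Ψ : Literature.MathematicalPhysics.QuantumManyBody.BoseGas.PeriodicTrialState N (Literature.MathematicalPhysics.QuantumManyBody.BoseGas.sideLength ρ N), Literature.MathematicalPhysics.QuantumManyBody.BoseGas.periodicEnergy v Ψ ≤ Literature.MathematicalPhysics.QuantumManyBody.BoseGas.periodicGroundStateEnergy v N (Literature.MathematicalPhysics.QuantumManyBody.BoseGas.sideLength ρ N) + δ → ∀ m : ℕ, 0 < m → let L := Literature.MathematicalPhysics.QuantumManyBody.BoseGas.sideLength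 ρ N; let ℓ := L / m; ℓ₀ ≤ ℓ → ℓ ≤ ℓ₁ → let φ : (Fin 3 → Fin m) → EuclideanSpace ℝ (Fin 3) → ℂ := fun z => ({x : EuclideanSpace ℝ (Fin 3) | ∀ k, x k ∈ Set.Ico (((z k : ℕ) : ℝ) * ℓ) ((((z k : ℕ) : ℝ) + 1) * ℓ)}).indicator (fun _ => ((Real.sqrt (ℓ ^ 3))⁻¹ : ℂ)); ∀ z z' : Fin 3 → Fin m, Literature.MathematicalPhysics.QuantumManyBody.BoseGas.cellOccupation N L (φ z) Ψ.ψ + Literature.MathematicalPhysics.QuantumManyBody.BoseGas.cellOccupation N L (φ z') Ψ.ψ + ENNReal.ofReal (2 * c * ρ * ℓ ^ 3) ≤ Literature.MathematicalPhysics.QuantumManyBody.BoseGas.cellOccupation N L (fun x => φ z x + φ z' x) Ψ.ψ) → (∀ v : ℝ → ENNReal, Literature.MathematicalPhysics.QuantumManyBody.BoseGas.IsRepulsiveFiniteRange v → ∃ ρ₀ : ℝ, 0 < ρ₀ ∧ ∀ ρ : ℝ, 0 < ρ → ρ < ρ₀ → ∃ c : ℝ, 0 < c ∧ ∀ᶠ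 N : ℕ in Filter.atTop, ∃ δ : ENNReal, 0 < δ ∧ ∀ Ψ : Literature.MathematicalPhysics.QuantumManyBody.BoseGas.PeriodicTrialState N (Literature.MathematicalPhysics.QuantumManyBody.BoseGas.sideLength ρ N), Literature.MathematicalPhysics.QuantumManyBody.BoseGas.periodicEnergy v Ψ ≤ Literature.MathematicalPhysics.QuantumManyBody.BoseGas.periodicGroundStateEnergy v N (Literature.MathematicalPhysics.QuantumManyBody.BoseGas.sideLength ρ N) + δ → ENNReal.ofReal (c * N) ≤ Literature.MathematicalPhysics.QuantumManyBody.BoseGas.condensateOccupation N (Literature.MathematicalPhysics.QuantumManyBody.BoseGas.sideLength ρ N) Ψ.ψ)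

/-- item stmt-AtomisticToContinuum-5825 · assembly · rank 1 · closed · moot by None · by planner
sources: LiebSeiringerSolovejYngvason2005, Fournais2020
[assembly] StiffPhaseLRO → PolarTransfer → BlockCoherenceToPeriodicBEC → BoundaryTransferWeak →
BoseEinsteinCondensation. -/
@[route_item "route-AtomisticToContinuum-BECPolarBlockRG"]
def Assembly : Prop :=
  StiffPhaseLRO → PolarTransfer → BlockCoherenceToPeriodicBEC → BoundaryTransferWeak → Literature.MathematicalPhysics.QuantumManyBody.BoseGas.BoseEinsteinCondensation

end Summit.AtomisticToContinuum.BoseEinsteinCondensation.Theses.BECPolarBlockRG
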